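import Summits.BirchSwinnertonDyer.BirchSwinnertonDyer.Theorems.GenusKolyvaginAtTwoShaCardDvdPowAtTwoRTShaAnnihilation
import Summits.BirchSwinnertonDyer.BirchSwinnertonDyer.Theorems.GenusKolyvaginAtTwoShaCardDvdPowAtTwoRSquareAllowance
import Summits.BirchSwinnertonDyer.BirchSwinnertonDyer.Theorems.GenusKolyvaginAtTwoCasselsTatePairingRat
import Literature.GroupTheory.FiniteAbelian.CoisotropicSeparationBound
import Literature.GroupTheory.FiniteAbelian.SymplecticModules
import HarnessLib

/-!
# Route `GenusKolyvaginAtTwo`, crux U_T `ShaCardDvdPowAtTwoRT` (stmt-BirchSwinnertonDyer-23658) —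
# THE SEPARATION SOCKET: `#Ш(E/K)[2^∞] ∣ 2^{2M₀}` ⟸ Kolyvagin classes whose Cassels–Tate characters separate a
# coisotropic subgroup of the (finite!) group `Ш(E/K)[2^∞]`, with total order `2^{M₀}` (McCallum Thm. 5.4 at `p = 2`, skeleton)

Seat `bsd-line-gk2-p4` g22 (WIDTH-5 attach, cell `bsd-f1-sign2`), `--supports stmt-BirchSwinnertonDyer-23658` (helper; closes nothing).
THEOREMS ONLY (no definition, no named fact, no `sorry`).  BSD is NOT proved by any of this; U_T is NOT proved: this file is
the sign-free SHAPE of the count, not the count.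

WHY.  U_T is the ORDER statement `#Ш(E/K)[2^∞] ∣ 2^{2M₀}` of Kolyvagin's theorem at `p = 2` on the habitat.  Its annihilation
half is landed (`…RTShaAnnihilation`, p746927: `Ш(E/K)[2^∞]` finite, killed by `2^{M₀+2}`); in print the order comes from
McCallum's Theorem 5.4: `Ш[p^∞]` finite ⟹ the Cassels–Tate pairing on it is nondegenerate alternating ⟹ a maximal isotropic
`D` has `#D² = #Ш[p^∞]`, and Kolyvagin classes `d_{M_{i−1}}(n_i)` (orders `≤ p^{M_{i−1}−M_i}`) whose Cassels–Tate characters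
form a triangular basis of `D^*` give `#D ≤ p^{Σ(M_{i−1}−M_i)} ≤ p^{M₀}`.  At `p = 2` the `±`-eigenspace bookkeeping of that
proof is unavailable, but the COUNT is sign-free (`Literature.GroupTheory.FiniteAbelian.natCard_dvd_pow_two_mul_of_separating`):
separation of a coisotropic `L` modulo a defect `Z` by classes `xᵢ` gives `#Ш[2^∞] ∣ (#Z · ∏ ord xᵢ)²`.

WHAT.
* §1 (any number field, any prime): `casselsTate_nondegenerate_on_primaryComponent` — an alternating pairing on `Ш(V/K)`
  with divisible kernel (the tree's `exists_casselsTate_pairing`, PROVED for every number field: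
  `WeierstrassCurve.exists_casselsTate_pairing_holds`) is NONDEGENERATE on a finite `Ш[p^∞]` (extracted from gk2-p3 g14's
  `isSquare_natCard_primaryComponent_sha_of_casselsTate`); `exists_casselsTate_lagrangian_primaryComponent` — hence a finite
  `Ш[p^∞]` has a Cassels–Tate LAGRANGIAN `L` (`L` isotropic, `L ⊇ L^⊥`, `(#L)² = #Ш[p^∞]`; Wall 1963 Lemma 7 in the tree).
* §2 (U_T's habitat, modulo Q2): `isSquare_natCard_sha_primaryComponent_two_onHabitat` (`#Ш(E/K)[2^∞]` is a square —
  unconditional now that it is finite); `natCard_sha_dvd_pow_iff_dvd_pow_succ_onHabitat` (U_T ⟺ U_T with ONE free bit);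
  **`natCard_sha_dvd_pow_of_ctSeparating_onHabitat` — THE SOCKET: for any bi-additive `ℚ/ℤ`-pairing `BT` on `Ш(E/K)[2^∞]`
  (e.g. the restricted Cassels–Tate pairing), any `L ⊇ L^⊥`, defect `Z ≤ L` and classes `xᵢ ∈ Ш(E/K)[2^∞]` separating `L`
  modulo `Z` with `#Z · ∏ ord xᵢ ∣ 2^m`: `#Ш(E/K)[2^∞] ∣ 2^{2m}`** (`m = M₀` is U_T's conclusion).

What a U_T line must still supply (the arithmetic): a Lagrangian `L` of `Ш(E/K)[2^∞]` adapted to complex conjugation, and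
Kolyvagin classes `d_M(n) ∈ Ш(E/K)[2^∞]` (orders `≤ 2^{M − ord₂ P_n}`, tree `…RTKolyvaginClassOrder*`) whose Cassels–Tate
characters (McCallum Prop. 4.7 = tree `…RTCrossPairLevelPairing` / `…RTSharpRungCertificate`) separate `L` modulo a defect
`Z` — gk2-p3 g25's memo `Cruxes/ShaCardDvdPowAtTwoRT/Lines/norm-sharp-upper-gk2p3.md` §15 locates the candidate defect (the
`τ`-fixed bottom layer `Z₀`); exactness of U_T needs `#Z · ∏ ord xᵢ ∣ 2^{M₀}` (or `2^{M₀}·√2`, by the free bit).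

References: [McCallumLMS1991] §1 Theorem, §5 (Thm. 5.4, Prop. 5.7, Cor. 5.6); [Cassels1962ArithmeticIV]; [MilneADT2006] I.6.13;
[Wall1963QuadraticFormsFiniteGroups] Lemma 7; [SilvermanAEC2009] Thm. X.4.14.
-/

set_option autoImplicit false
-- the Theorems namespace of this sub repeats the summit name by design (D-0017 nested layout)
set_option linter.dupNamespace false

noncomputable section

open scoped Classical
open scoped AddSubgroup

namespace Summit.BirchSwinnertonDyer.BirchSwinnertonDyer.Theorems.GenusExact.PlusDescent

open WeierstrassCurve NumberField IsDedekindDomain Field Literature.NumberTheory.EllipticCurves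
  Literature.NumberTheory.GaloisRepresentations Literature.NumberTheory.EllipticCurves.ModularForms AddSubgroup
open Literature.GroupTheory.FiniteAbelian
open Summit.BirchSwinnertonDyer.BirchSwinnertonDyer.Theses.GenusKolyvaginAtTwo (KolyvaginRelationAtTwo)
open Summit.BirchSwinnertonDyer.Rank1Residual

/-! ## §1 The Cassels–Tate pairing on a finite `Ш[p^∞]`: nondegenerate, with a Lagrangian -/

section CasselsTate

variable {F : Type} [Field F] [NumberField F] (V : WeierstrassCurve F) [V.IsElliptic] (p : ℕ) [hp : Fact p.Prime]

/-- Two coprime annihilators kill: `a • x = 0`, `b • x = 0`, `a ⊥ b` ⟹ `x = 0`. [folklore] -/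
private theorem eq_zero_of_coprime_nsmul'' {Q : Type*} [AddCommGroup Q] {x : Q} {a b : ℕ} (hab : a.Coprime b)
    (ha : a • x = 0) (hb : b • x = 0) : x = 0 := by
  rw [← addOrderOf_dvd_iff_nsmul_eq_zero] at ha hb
  exact AddMonoid.addOrderOf_eq_one_iff.mp (Nat.eq_one_of_dvd_coprimes hab ha hb)

omit [V.IsElliptic] in
/-- **An alternating pairing on `Ш(V/F)` with divisible kernel is nondegenerate on a finite `Ш(V/F)[p^∞]`** (any elliptic `V`
over any number field `F`, any prime `p`): an element of `Ш[p^∞]` orthogonal to `Ш[p^∞]` is orthogonal to all of the torsion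
group `Ш` (coprime orders), hence divisible in `Ш`, hence `p^{#Ш[p^∞]}`-divisible with a `p`-primary root, hence `0`.  This is the
nondegeneracy step inside gk2-p3 g14's `isSquare_natCard_primaryComponent_sha_of_casselsTate`, exported.
[cite: SilvermanAEC2009, Thm. X.4.14] [cite: MilneADT2006, Ch. I Thm. 6.13] [cite: Cassels1962ArithmeticIV] -/
theorem casselsTate_nondegenerate_on_primaryComponent (B : V.sha →+ V.sha →+ AddCircle (1 : ℚ))
    (hkerB : ∀ x, (∀ y, B x y = 0) ↔ x ∈ AddSubgroup.divisibleElements V.sha)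
    [Finite (AddCommGroup.primaryComponent V.sha p)] :
    ∀ a : AddCommGroup.primaryComponent V.sha p, (∀ b : AddCommGroup.primaryComponent V.sha p, B a b = 0) → a = 0 := by
  set A : AddSubgroup V.sha := AddCommGroup.primaryComponent V.sha p with hAdef
  intro a ha
  have hA : ∀ a : A, ∃ n : ℕ, p ^ n • a = 0 := fun a ↦ by
    obtain ⟨n, hn⟩ := (AddCommGroup.mem_primaryComponent).mp a.2
    exact ⟨n, Subtype.ext hn⟩
  obtain ⟨e, he⟩ := hA a
  -- `a` is orthogonal to all of `Ш`
  have hall : ∀ z : V.sha, B a z = 0 := by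
    intro z
    have hz := V.isTorsion_sha z
    set n := addOrderOf z with hn
    have hn0 : n ≠ 0 := (hz.addOrderOf_pos).ne'
    obtain ⟨v, m, hm, hnm⟩ := Nat.exists_eq_pow_mul_and_not_dvd hn0 p hp.out.ne_one
    have hmz : m • z ∈ A := by
      rw [hAdef, AddCommGroup.mem_primaryComponent]
      refine ⟨v, ?_⟩
      rw [smul_smul, ← hnm, hn, addOrderOf_nsmul_eq_zero]
    have h1 : m • B a z = 0 := by
      rw [← map_nsmul]
      exact ha ⟨m • z, hmz⟩
    have h2 : p ^ e • B a z = 0 := by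
      rw [← AddMonoidHom.nsmul_apply, ← map_nsmul]
      have : (p ^ e • a : A) = 0 := he
      rw [← AddSubgroupClass.coe_nsmul, this, ZeroMemClass.coe_zero, map_zero, AddMonoidHom.zero_apply]
    exact eq_zero_of_coprime_nsmul'' (Nat.Coprime.pow_left e ((Nat.Prime.coprime_iff_not_dvd hp.out).mpr hm)) h2 h1
  -- hence divisible in `Ш`: `a = p^k • y` with `y ∈ A`, for `k = #A`
  have hdivz : ((a : A) : V.sha) ∈ AddSubgroup.divisibleElements V.sha := (hkerB _).mp hall
  set k : ℕ := Nat.card A with hk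
  obtain ⟨y, hy⟩ := (AddSubgroup.mem_divisibleElements_iff _ _).mp hdivz (p ^ k) (pow_pos hp.out.pos k)
  have hyA : y ∈ A := by
    rw [hAdef, AddCommGroup.mem_primaryComponent]
    refine ⟨k + e, ?_⟩
    rw [pow_add, mul_comm, ← smul_smul, hy, ← AddSubgroupClass.coe_nsmul]
    have : (p ^ e • a : A) = 0 := he
    rw [this, ZeroMemClass.coe_zero]
  -- `p^k` kills `y ∈ A`
  have hy0 : p ^ k • (⟨y, hyA⟩ : A) = 0 := by
    obtain ⟨n, hn⟩ := hA ⟨y, hyA⟩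
    have hdvd : addOrderOf (⟨y, hyA⟩ : A) ∣ p ^ n := addOrderOf_dvd_iff_nsmul_eq_zero.mpr hn
    obtain ⟨j, -, hj⟩ := (Nat.dvd_prime_pow hp.out).mp hdvd
    have hjk : p ^ j ∣ k := hj ▸ addOrderOf_dvd_natCard (⟨y, hyA⟩ : A)
    have hkpos : 0 < k := Nat.card_pos
    have hjlt : j < k := lt_of_lt_of_le (Nat.lt_pow_self hp.out.one_lt) (Nat.le_of_dvd hkpos hjk)
    apply addOrderOf_dvd_iff_nsmul_eq_zero.mp
    rw [hj]
    exact pow_dvd_pow p hjlt.le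
  apply Subtype.ext
  rw [ZeroMemClass.coe_zero, ← hy]
  have := congrArg (fun t : A ↦ (t : V.sha)) hy0
  simpa only [AddSubgroupClass.coe_nsmul, ZeroMemClass.coe_zero] using this

/-- **A finite `Ш(V/F)[p^∞]` has a Cassels–Tate Lagrangian**: with `B` the Cassels–Tate pairing (alternating, divisible kernel —
PROVED over every number field, `WeierstrassCurve.exists_casselsTate_pairing_holds`) and `BT` its restriction to the finite group
`T = Ш[p^∞]`, there is `L ≤ T` with `BT(L, L) = 0`, `L ⊇ L^⊥` and `(#L)² = #T` (Wall 1963 Lemma 7 = tree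
`FiniteAbelian.exists_lagrangian_sq_eq_card`; McCallum §5 «the elementary divisors of `Ш(E/K)` come in pairs»).
[cite: Wall1963QuadraticFormsFiniteGroups, Lemma 7] [cite: McCallumLMS1991, §5 (p. 307)] [cite: SilvermanAEC2009, Thm. X.4.14] -/
theorem exists_casselsTate_lagrangian_primaryComponent [Finite (AddCommGroup.primaryComponent V.sha p)] :
    ∃ B : V.sha →+ V.sha →+ AddCircle (1 : ℚ), (∀ x, B x x = 0) ∧
      (∀ x, (∀ y, B x y = 0) ↔ x ∈ AddSubgroup.divisibleElements V.sha) ∧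
      ∃ L : AddSubgroup (AddCommGroup.primaryComponent V.sha p),
        (∀ a ∈ L, ∀ b ∈ L, B a b = 0) ∧
        (∀ t : AddCommGroup.primaryComponent V.sha p, (∀ s ∈ L, B t s = 0) → t ∈ L) ∧
        Nat.card L ^ 2 = Nat.card (AddCommGroup.primaryComponent V.sha p) := by
  obtain ⟨B, halt, hkerB⟩ := WeierstrassCurve.exists_casselsTate_pairing_holds (K := F) V
  set A : AddSubgroup V.sha := AddCommGroup.primaryComponent V.sha p with hAdef
  let BA : A →+ A →+ AddCircle (1 : ℚ) := (AddMonoidHom.compHom' A.subtype).comp (B.comp A.subtype)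
  have hBA : ∀ a b : A, BA a b = B a b := fun _ _ ↦ rfl
  have hBAalt : ∀ a : A, BA a a = 0 := fun a ↦ by rw [hBA, halt]
  have hnd : ∀ a : A, (∀ b : A, BA a b = 0) → a = 0 := fun a ha ↦
    casselsTate_nondegenerate_on_primaryComponent V p B hkerB a (fun b ↦ by rw [← hBA]; exact ha b)
  obtain ⟨L, hLiso, hLco, hLcard⟩ := exists_lagrangian_sq_eq_card BA hBAalt hnd
  exact ⟨B, halt, hkerB, L, fun a ha b hb ↦ by rw [← hBA]; exact hLiso a ha b hb,
    fun t ht ↦ hLco t (fun s hs ↦ by rw [hBA]; exact ht s hs), hLcard⟩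

end CasselsTate

/-! ## §2 On U_T's habitat -/

/-- **`#Ш(E/K)[2^∞]` is a SQUARE on U_T's habitat, unconditionally (modulo Q2)**: finite by `sha_primaryComponent_two_onHabitat`
(p746927), square by the Cassels–Tate pairing PROVED over every number field (`exists_casselsTate_pairing_holds`, gk2-p1 g13) and
gk2-p3 g14's `isSquare_natCard_primaryComponent_sha_of_casselsTate`. [cite: SilvermanAEC2009, Thm. X.4.14] [cite: Cassels1962ArithmeticIV] -/
theorem isSquare_natCard_sha_primaryComponent_two_onHabitat (hQ2 : KolyvaginRelationAtTwo)
    (W : WeierstrassCurve ℚ) [W.IsElliptic] [W.IsGloballyMinimal] [NeZero (W.conductorNorm ℤ)] (hcm : ¬ W.HasCM)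
    (hT : Odd W.tamagawaProduct) (v : HeightOneSpectrum (𝓞 ℚ)) (h2v : ((2 : ℕ) : 𝓞 ℚ) ∉ v.asIdeal)
    (hNv : ((W.conductorNorm ℤ : ℕ) : 𝓞 ℚ) ∈ v.asIdeal) (hmult : W.HasMultiplicativeReductionAt v) (hneg : W.Δ < 0)
    (K : Type) [Field K] [NumberField K] (hIQ : IsImaginaryQuadratic K) (hodd : Odd (NumberField.discr K))
    (h3 : NumberField.discr K ≠ -3) (hHe : SatisfiesHeegnerHypothesis (W.conductorNorm ℤ) K)
    (hsq1 : ¬ IsSquare ((NumberField.discr K : ℚ) * -|W.Δ|)) (hsq2 : ¬ IsSquare ((NumberField.discr K : ℚ) * (-(2 * |W.Δ|))))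
    (hρ : ∀ n : ℕ, 0 < n → W.HasSurjectiveModNGaloisRep ((2 : ℤ) ^ n))
    (Dt : ModularParametrizationData W (W.conductorNorm ℤ)) (β : ℤ) (ι : K →+* ℂ) (d₁ : KolyvaginHeegnerData Dt β ι 1) (M₀ : ℕ)
    (hndiv : ¬ ∃ Q : (W.baseChange (ringClassField K ι 1)).toAffine.Point, ((2 ^ (M₀ + 1) : ℕ) : ℤ) • Q = d₁.derivedPoint) :
    IsSquare (Nat.card (AddCommGroup.primaryComponent (W.baseChange K).sha 2)) := by
  haveI : Fact (Nat.Prime 2) := ⟨Nat.prime_two⟩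
  haveI hell : (W.baseChange K).IsElliptic := inferInstanceAs ((W.map (algebraMap ℚ K)).IsElliptic)
  haveI : Finite (AddCommGroup.primaryComponent (W.baseChange K).sha 2) :=
    (sha_primaryComponent_two_onHabitat hQ2 W hcm hT v h2v hNv hmult hneg K hIQ hodd h3 hHe hsq1 hsq2 hρ Dt β ι d₁ M₀ hndiv).1
  exact VisiblePairAtTwo.isSquare_natCard_primaryComponent_sha_of_casselsTate (W.baseChange K) 2
    WeierstrassCurve.exists_casselsTate_pairing_holds

/-- **U_T ⟺ U_T with one free bit** on the habitat: `#Ш(E/K)[2^∞] ∣ 2^{2M₀} ↔ #Ш(E/K)[2^∞] ∣ 2^{2M₀+1}` (a square — and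
`#Ш(E/K)[2^∞]` is one, unconditionally — dividing `2^{2M₀+1}` divides `2^{2M₀}`; gk2-p3 g14's
`natCard_sha_dvd_pow_of_dvd_pow_succ` with its Cassels–Tate hypothesis discharged).  So a separation argument may lose ONE bit in
total for free. [cite: SilvermanAEC2009, Thm. X.4.14] [cite: McCallumLMS1991, Thm. 5.4] -/
theorem natCard_sha_dvd_pow_iff_dvd_pow_succ {F : Type} [Field F] [NumberField F] (V : WeierstrassCurve F) [V.IsElliptic]
    (M₀ : ℕ) :
    Nat.card (AddCommGroup.primaryComponent V.sha 2) ∣ 2 ^ (2 * M₀) ↔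
      Nat.card (AddCommGroup.primaryComponent V.sha 2) ∣ 2 ^ (2 * M₀ + 1) :=
  ⟨fun h ↦ h.trans (pow_dvd_pow 2 (Nat.le_succ _)),
    VisiblePairAtTwo.natCard_sha_dvd_pow_of_dvd_pow_succ WeierstrassCurve.exists_casselsTate_pairing_holds V⟩

/-- **THE SEPARATION SOCKET for U_T (McCallum Thm. 5.4, upper half, at `p = 2`, skeleton).**  On U_T's habitat (modulo Q2), let
`T = Ш(E/K)[2^∞]` (FINITE, `sha_primaryComponent_two_onHabitat`), `BT : T × T → ℚ/ℤ` any bi-additive pairing (intended: the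
restricted Cassels–Tate pairing of `exists_casselsTate_lagrangian_primaryComponent`), `L ≤ T` a subgroup containing its own
`BT`-orthogonal (e.g. a Lagrangian), `Z ≤ L` a defect subgroup, and `x₁, …, x_r ∈ T` classes (intended: Kolyvagin's
`d_M(n)`) whose characters `BT(xᵢ, ·)` separate `L` modulo `Z`.  If `#Z · ∏ᵢ ord xᵢ ∣ 2^m` then **`#Ш(E/K)[2^∞] ∣ 2^{2m}`**; at
`m = M₀` this is U_T's conclusion, at `m = M₀ − M_r` McCallum's.  Pure counting
(`Literature.GroupTheory.FiniteAbelian.natCard_dvd_pow_two_mul_of_separating`) + finiteness; sign-free.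
[cite: McCallumLMS1991, §5, proof of Thm. 5.4, Prop. 5.7, Cor. 5.6] [cite: Kolyvagin1990, Thm. A] -/
theorem natCard_sha_dvd_pow_of_ctSeparating_onHabitat (hQ2 : KolyvaginRelationAtTwo)
    (W : WeierstrassCurve ℚ) [W.IsElliptic] [W.IsGloballyMinimal] [NeZero (W.conductorNorm ℤ)] (hcm : ¬ W.HasCM)
    (hT : Odd W.tamagawaProduct) (v : HeightOneSpectrum (𝓞 ℚ)) (h2v : ((2 : ℕ) : 𝓞 ℚ) ∉ v.asIdeal)
    (hNv : ((W.conductorNorm ℤ : ℕ) : 𝓞 ℚ) ∈ v.asIdeal) (hmult : W.HasMultiplicativeReductionAt v) (hneg : W.Δ < 0)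
    (K : Type) [Field K] [NumberField K] (hIQ : IsImaginaryQuadratic K) (hodd : Odd (NumberField.discr K))
    (h3 : NumberField.discr K ≠ -3) (hHe : SatisfiesHeegnerHypothesis (W.conductorNorm ℤ) K)
    (hsq1 : ¬ IsSquare ((NumberField.discr K : ℚ) * -|W.Δ|)) (hsq2 : ¬ IsSquare ((NumberField.discr K : ℚ) * (-(2 * |W.Δ|))))
    (hρ : ∀ n : ℕ, 0 < n → W.HasSurjectiveModNGaloisRep ((2 : ℤ) ^ n))
    (Dt : ModularParametrizationData W (W.conductorNorm ℤ)) (β : ℤ) (ι : K →+* ℂ) (d₁ : KolyvaginHeegnerData Dt β ι 1) (M₀ : ℕ)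
    (hndiv : ¬ ∃ Q : (W.baseChange (ringClassField K ι 1)).toAffine.Point, ((2 ^ (M₀ + 1) : ℕ) : ℤ) • Q = d₁.derivedPoint)
    (BT : AddCommGroup.primaryComponent (W.baseChange K).sha 2 →+ AddCommGroup.primaryComponent (W.baseChange K).sha 2 →+
      AddCircle (1 : ℚ))
    (L Z : AddSubgroup (AddCommGroup.primaryComponent (W.baseChange K).sha 2)) (hZL : Z ≤ L)
    (hL : ∀ t : AddCommGroup.primaryComponent (W.baseChange K).sha 2, (∀ s ∈ L, BT t s = 0) → t ∈ L)
    {ι' : Type*} [Fintype ι'] (x : ι' → AddCommGroup.primaryComponent (W.baseChange K).sha 2)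
    (hsep : ∀ s ∈ L, (∀ i, BT (x i) s = 0) → s ∈ Z) {m : ℕ} (hm : Nat.card Z * ∏ i, addOrderOf (x i) ∣ 2 ^ m) :
    Nat.card (AddCommGroup.primaryComponent (W.baseChange K).sha 2) ∣ 2 ^ (2 * m) := by
  haveI : Finite (AddCommGroup.primaryComponent (W.baseChange K).sha 2) :=
    (sha_primaryComponent_two_onHabitat hQ2 W hcm hT v h2v hNv hmult hneg K hIQ hodd h3 hHe hsq1 hsq2 hρ Dt β ι d₁ M₀ hndiv).1
  exact natCard_dvd_pow_two_mul_of_separating BT L Z hZL hL x hsep hm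

end Summit.BirchSwinnertonDyer.BirchSwinnertonDyer.Theorems.GenusExact.PlusDescent

end
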